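import Literature.MathematicalPhysics.QuantumFieldTheory.Balaban1983to89.B15TreeGauge196Walks

/-!
# `Balaban1983to89.B16Ineq382Stokes` — T. Bałaban, *Large field renormalization. II. Localization, exponentiation, and bounds for the 𝐑 operation*, Commun. Math. Phys. **122** (1989) 355–392 [Balaban1989LargeFieldII], p. 382 l. 1 *"By elementary reasoning, the same as in the proof of Lemma 1 [14], we obtain the estimate |V₁(b) − 1| < …"*: the elementary reasoning — non-abelian Stokes estimates for ladders, wide ladders (rectangles) and shifted closed loops over the `ℤ^d` words of `B7Prop1Explicit`, with plaquette hypotheses LOCALIZED to a set of sites (PART 1/2 of the case-1 estimate of p. 382)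

statement-level skeleton of published theorems with citation tags; proofs where landed; nothing here is a claim about the Yang–Mills mass gap

PDF held: `paper:balaban1989-cmp122-large-field-ii` (journal page = PDF page + 354; pp. 381–382 = PDF pp. 27–28,
re-read AS IMAGES: `run/shared/lean/pub/pub-balaban/b2b-balaban-ref1/pages/1989-cmp122-large-field-II/…-p027-x2.png`,
`…-p028-x2.png`); [14] = [Balaban1985RegularSpaces] (`paper:balaban1985-cmp99-regular-spaces-gauge-fixing`, Lemma 1
p. 79; its tree version `B8Lemma1NonAbelian`).

WHAT IS REPRODUCED (mega-formalization `lit-balaban`, HOME `run/shared/lean/pub/lit-balaban/`, Phase-2 seat p26,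
generation 2; SKELETON row `B16.Lem@381`, referee ref-5).  The "elementary reasoning" of Lemma 1 [14] as used on
p. 382: in a gauge in which the bond variables along the contours `Γ_{y,b₋}`, `Γ_{y,b₊}` equal `1`, a bond variable
`V₁(b)` is (conjugate to) the holonomy of the closed loop `Γ_{y,b₋} ∪ b ∪ Γ_{y,b₊}⁻¹`, and the holonomy of a closed
loop spanned by plaquettes `p′` with `|V(∂p′) − 1| < ε` deviates from `1` by at most (number of plaquettes)·`ε`
(non-abelian Stokes: conjugation invariance of the norm under the gauge group and `‖ab − 1‖ ≤ ‖a − 1‖ + ‖b − 1‖` for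
`‖a‖ ≤ 1`).  TYPED/PROVED here, over the `ℤ^d` words (9) of [Balaban1985Averaging] (`B7Prop1Explicit.hol`, `ladder`,
`plaqWord`, `seg`, the group `U1 𝔸 ⊇ U(N)`): `PlaqSmallOn A V ε` (the hypothesis *"|V″(∂p′) − 1| < ε for p′ ⊂
Ω″^{~2}_{h+1}∖Ω″_{h+1}"* of p. 381: every plaquette with its four corners in the site set `A`), its invariance under
`U1`-valued gauge transformations; `bond_eq_conj_loop` (the bond between the ends of two gauge-trivial paths is the
conjugated loop holonomy); `norm_hol_ladder_sub_one_le` (thin strips, via the tree's `ladder_bound_local`);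
`wideLadder w ν b` (the strip swept by a path moved `b` steps; a rectangle for a straight path) with
`norm_hol_wideLadder_sub_one_le` (`≤ b·|w|·ε`); `norm_hol_shift_sub_one_le` (a closed loop moved `h` steps in a
direction avoiding an obstacle: `≤ h·|w|·ε +` the loop at the base level); the vertices of a rectangle boundary
(`pathIn_wideLadder_seg`).  PART 2 (`B16Ineq382TreeGauge`) applies these to the contours of [Balaban1989LargeFieldI]
p. 196 (`B15TreeGauge196*`) and proves the printed `|V₁(b) − 1| < 6(100MR_{j−N+1})²ε`.

HONEST SCOPE.  Model = the tree's (`B7Prop1Explicit`, `B8Lemma1NonAbelian`): `U1 𝔸`-valued bond fields on `ℤ^d`,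
`𝔸` a normed ring with `‖1‖ = 1` (contains `U(N) ⊂ M_N(ℂ)` with the operator norm); `≤` where the print has `<`.
Every declaration is a definition with a body or a proved lemma; nothing of [IV]/[V] is asserted.  Unit
`lit-balaban-p26` (literature-prover-lit-balaban-p26-g2-0).
-/

noncomputable section

open scoped BigOperators

namespace Literature.MathematicalPhysics.QuantumFieldTheory.Balaban1983to89.B16Ineq382

open B7Prop1Explicit B8Lemma1NonAbelian B15TreeGauge196

-- `Site` alone would resolve to the torus sites of `Setup.lean`: re-export the `ℤ^d` sites (as `B8Lemma1NonAbelian`).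
export B7Prop1Explicit (Site)

variable {d : ℕ}

/-! ## §1 Algebra: a bond between the ends of two gauge-trivial paths is a conjugated loop holonomy -/

section Algebra

variable {G : Type*} [Group G]

/-- **Two paths.**  If `g·V(u) = 1` and `g·V(u′) = 1` for two paths `u`, `u′` from `p` ending at `b₋` and `b₊ = b₋ +
e_μ`, then `V(b) = g · V(u ∪ b ∪ u′⁻¹) · g⁻¹` — p. 381 "V₁ … satisfies … the axial gauge conditions", p. 382 "the same
reasoning as in the proof of Lemma 1 [14]" (there: "(R₀V′)(Γ_{y,x}) = 1 … imply V′_b = 1 for b ⊂ Γ_{y,x}").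
[cite: Balaban1989LargeFieldII, p.382] -/
theorem bond_eq_conj_loop (V : Site d → Fin d → G) (g : G) (p : Site d) (u u' : List (Letter d)) (μ : Fin d)
    (hend : disp u' = disp u + e μ) (hgu : g * hol V p u = 1) (hgu' : g * hol V p u' = 1) :
    V (p + disp u) μ = g * hol V p (u ++ (μ, true) :: revWord u') * g⁻¹ := by
  rw [hol_append, hol_cons, stepHol_true, Letter.vec_true,
    hol_revWord' V (x := p) (p + disp u + e μ) u' (by rw [hend, add_assoc]),
    eq_inv_of_mul_eq_one_right hgu, eq_inv_of_mul_eq_one_right hgu', inv_inv]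
  group

/-- **Two paths differing by the bond**: `u′ = [+e_μ] ∪ (u + e_μ)` gives the ladder loop of the tree,
`V(b) = g · V(ladder u μ) · g⁻¹`. [cite: Balaban1989LargeFieldII, p.382] -/
theorem bond_eq_conj_ladder (V : Site d → Fin d → G) (g : G) (p : Site d) (u : List (Letter d)) (μ : Fin d)
    (hgu : g * hol V p u = 1) (hgu' : g * (V p μ * hol V (p + e μ) u) = 1) :
    V (p + disp u) μ = g * hol V p (ladder u μ) * g⁻¹ := by
  have h := bond_eq_conj_loop V g p u ((μ, true) :: u) μ (by rw [disp_cons, Letter.vec_true, add_comm])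
    hgu (by rwa [hol_cons, stepHol_true, Letter.vec_true])
  rw [h, revWord_cons, ladder]
  simp [List.append_assoc]

/-- **The wide ladder**: the closed loop `w ∪ [b steps of +e_ν] ∪ (w⁻¹ shifted) ∪ [b steps back]` — the boundary of
the strip swept by the path `w` moved `b` times in direction `ν`; for `w` a straight segment of `a` steps it is the
boundary of an `a × b` rectangle of plaquettes. [cite: Balaban1989LargeFieldII, p.382] -/
def wideLadder (w : List (Letter d)) (ν : Fin d) (b : ℕ) : List (Letter d) :=
  w ++ seg ν (b : ℤ) ++ revWord w ++ seg ν (-(b : ℤ))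

/-- The wide ladder is a closed loop. [cite: Balaban1989LargeFieldII, p.382] -/
@[simp] theorem disp_wideLadder (w : List (Letter d)) (ν : Fin d) (b : ℕ) : disp (wideLadder w ν b) = 0 := by
  simp [wideLadder]

/-- The directions of the letters of a rectangle boundary. [cite: Balaban1989LargeFieldII, p.382] -/
theorem fst_eq_of_mem_wideLadder_seg {κ ν : Fin d} {a b : ℕ} {l : Letter d}
    (h : l ∈ wideLadder (seg κ (a : ℤ)) ν b) : l.1 = κ ∨ l.1 = ν := by
  simp only [wideLadder, List.mem_append] at h
  rcases h with ((h | h) | h) | h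
  · exact Or.inl (mem_seg h)
  · exact Or.inr (mem_seg h)
  · exact Or.inl (by simpa using mem_seg (mem_revWord h))
  · exact Or.inr (mem_seg h)

/-- The holonomy of the wide ladder: `V(w) · V([b e_ν] at the end of w) · V(w shifted by b e_ν)⁻¹ · V([b e_ν] at p)⁻¹`.
[cite: Balaban1989LargeFieldII, p.382] -/
theorem hol_wideLadder (V : Site d → Fin d → G) (p : Site d) (w : List (Letter d)) (ν : Fin d) (b : ℕ) :
    hol V p (wideLadder w ν b) = hol V p w * hol V (p + disp w) (seg ν (b : ℤ)) *
      (hol V (p + (b : ℤ) • e ν) w)⁻¹ * (hol V p (seg ν (b : ℤ)))⁻¹ := by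
  have h1 : hol V (p + (disp w + (b : ℤ) • e ν)) (revWord w) = (hol V (p + (b : ℤ) • e ν) w)⁻¹ :=
    hol_revWord' V _ w (by abel)
  have h2 : hol V (p + (disp w + (b : ℤ) • e ν + -disp w)) (seg ν (-(b : ℤ))) = (hol V p (seg ν (b : ℤ)))⁻¹ := by
    rw [← revWord_seg]; exact hol_revWord' V _ _ (by rw [disp_seg]; abel)
  simp only [wideLadder, hol_append, disp_append, disp_seg, disp_revWord]
  rw [h1, h2]

/-- One more row: `V(wideLadder w ν (b+1)) = V(ladder w ν) · (V(p,ν) · V(wideLadder w ν b from p + e_ν) · V(p,ν)⁻¹)`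
— the recursion behind "number of plaquettes × ε". [cite: Balaban1989LargeFieldII, p.382] -/
theorem hol_wideLadder_succ (V : Site d → Fin d → G) (p : Site d) (w : List (Letter d)) (ν : Fin d) (b : ℕ) :
    hol V p (wideLadder w ν (b + 1)) =
      hol V p (ladder w ν) * (V p ν * hol V (p + e ν) (wideLadder w ν b) * (V p ν)⁻¹) := by
  have hs : ∀ q : Site d, hol V q (seg ν ((b + 1 : ℕ) : ℤ)) = V q ν * hol V (q + e ν) (seg ν (b : ℤ)) := fun q => by
    rw [seg_natCast, seg_natCast, List.replicate_succ, hol_cons, stepHol_true, Letter.vec_true]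
  rw [hol_wideLadder, hol_wideLadder, hol_ladder, hs, hs,
    show p + e ν + disp w = p + disp w + e ν by abel,
    show p + e ν + (b : ℤ) • e ν = p + ((b + 1 : ℕ) : ℤ) • e ν by push_cast; rw [add_zsmul, one_zsmul]; abel]
  group

/-- A closed loop moved one step in direction `ν`: `V(w from p + e_ν) = V(p,ν)⁻¹ · V(ladder w ν)⁻¹ · V(w from p) ·
V(p,ν)`. [cite: Balaban1989LargeFieldII, p.382] -/
theorem hol_shift_of_closed (V : Site d → Fin d → G) (p : Site d) (w : List (Letter d)) (ν : Fin d)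
    (hw : disp w = 0) :
    hol V (p + e ν) w = (V p ν)⁻¹ * ((hol V p (ladder w ν))⁻¹ * hol V p w) * V p ν := by
  rw [hol_ladder, hw, add_zero]; group

end Algebra

/-! ## §2 The estimates: plaquettes with corners in a set of sites -/

section Estimates

variable {𝔸 : Type*} [NormedRing 𝔸] [NormOneClass 𝔸]

/-- p. 381: *"Assume that the plaquette variables of V″ on this domain are small, i.e., |V″(∂p′) − 1| < ε for
p′ ⊂ Ω″^{~2}_{h+1}∖Ω″_{h+1}"* — the plaquette hypothesis LOCALIZED to a set `A` of sites: every unit plaquette with its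
four corners in `A` deviates from `1` by at most `ε` (here `≤`). [cite: Balaban1989LargeFieldII, p.381] -/
def PlaqSmallOn (A : Set (Site d)) (V : Site d → Fin d → 𝔸ˣ) (ε : ℝ) : Prop :=
  ∀ (z : Site d) (κ μ : Fin d), κ ≠ μ → z ∈ A → z + e κ ∈ A → z + e μ ∈ A → z + e κ + e μ ∈ A →
    ‖((hol V z (plaqWord κ μ) : 𝔸ˣ) : 𝔸) - 1‖ ≤ ε

variable {A : Set (Site d)} {V : Site d → Fin d → 𝔸ˣ} {ε : ℝ}

/-- A gauge transformation with values in `U1` preserves the localized plaquette hypothesis (`|V^u(∂p) − 1| ≤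
|V(∂p) − 1|`, conjugation; p. 381 "transform the field V″ into a field satisfying the axial gauge conditions").
[cite: Balaban1989LargeFieldII, p.381] -/
theorem PlaqSmallOn.gaugeAct (h : PlaqSmallOn A V ε) {u : Site d → 𝔸ˣ} (hu : ∀ x, u x ∈ U1 𝔸) :
    PlaqSmallOn A (gaugeAct u V) ε := by
  intro z κ μ hκμ h1 h2 h3 h4
  rw [hol_gaugeAct_closed _ _ _ _ (disp_plaqWord κ μ), Units.val_mul, Units.val_mul]
  exact (norm_units_conj_sub_one_le (hu z) _).trans (h z κ μ hκμ h1 h2 h3 h4)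

/-- The elementary loop spanned by a letter `l` (forward or backward) and `+e_μ` at `z` deviates by at most `ε` when
its four corners `z, z + l, z + e_μ, z + l + e_μ` are in `A` (a backward letter gives the inverse plaquette at
`z − e_κ` conjugated by a bond variable). [cite: Balaban1989LargeFieldII, p.382] -/
theorem lplaq_small (hV : ∀ x κ, V x κ ∈ U1 𝔸) (hP : PlaqSmallOn A V ε) (z : Site d) (l : Letter d) (μ : Fin d)
    (hl : l.1 ≠ μ) (h1 : z ∈ A) (h2 : z + l.vec ∈ A) (h3 : z + e μ ∈ A) (h4 : z + l.vec + e μ ∈ A) :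
    ‖((hol V z (lplaqWord l μ) : 𝔸ˣ) : 𝔸) - 1‖ ≤ ε := by
  obtain ⟨κ, b⟩ := l
  cases b
  · have hid : hol V z (lplaqWord (κ, false) μ) =
        (V (z - e κ) κ)⁻¹ * (hol V (z - e κ) (plaqWord κ μ))⁻¹ * V (z - e κ) κ := by
      simp only [lplaqWord, plaqWord, hol_cons, hol_nil, mul_one, stepHol_true, stepHol_false, Letter.rev_mk,
        Bool.not_false, Letter.vec_true, Letter.vec_false, mul_inv_rev, inv_inv]
      abel_nf
      group
    have h2' : z - e κ ∈ A := by simpa [sub_eq_add_neg] using h2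
    have h4' : z - e κ + e μ ∈ A := by simpa [sub_eq_add_neg] using h4
    rw [hid, Units.val_mul, Units.val_mul]
    refine (norm_units_inv_conj_sub_one_le (hV _ _) _).trans ((norm_inv_sub_one_le (hol_mem hV _ _)).trans ?_)
    exact hP (z - e κ) κ μ hl h2' (by rwa [sub_add_cancel]) h4'
      (by rwa [show z - e κ + e κ + e μ = z + e μ by abel])
  · rw [lplaqWord_true]
    exact hP z κ μ hl h1 (by simpa using h2) h3 (by simpa using h4)

/-- **Thin strip (ladder)**: if both long sides of the ladder over the path `u` — `u` from `q` and `u` from `q + e_μ`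
— have their vertices in `A`, the ladder loop deviates by at most `|u|·ε` (the tree's `ladder_bound_local` with the
plaquette hypotheses discharged from `PlaqSmallOn`). [cite: Balaban1989LargeFieldII, p.382] -/
theorem norm_hol_ladder_sub_one_le (hV : ∀ x κ, V x κ ∈ U1 𝔸) (hP : PlaqSmallOn A V ε) (μ : Fin d)
    (u : List (Letter d)) (q : Site d) (hu : ∀ l ∈ u, l.1 ≠ μ) (h1 : PathIn A q u) (h2 : PathIn A (q + e μ) u) :
    ‖((hol V q (ladder u μ) : 𝔸ˣ) : 𝔸) - 1‖ ≤ u.length * ε := by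
  refine ladder_bound_local V hV μ u q hu fun w₁ w₂ l hw => ?_
  have hl : l.1 ≠ μ := hu l (by rw [hw]; simp)
  refine lplaq_small hV hP _ l μ hl (h1 w₁ (l :: w₂) hw) ?_ ?_ ?_
  · have := h1 (w₁ ++ [l]) w₂ (by rw [hw]; simp)
    simpa [add_assoc] using this
  · have := h2 w₁ (l :: w₂) hw
    rwa [add_right_comm] at this
  · have := h2 (w₁ ++ [l]) w₂ (by rw [hw]; simp)
    rw [disp_append, disp_cons, disp_nil, add_zero] at this
    convert this using 1
    abel

/-- **Bond from two gauge-trivial paths differing by the bond** (the usual situation in the tree gauge): `‖V(b) − 1‖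
≤ |u|·ε`. [cite: Balaban1989LargeFieldII, p.382] -/
theorem norm_bond_sub_one_le_of_ladder (hV : ∀ x κ, V x κ ∈ U1 𝔸) (hP : PlaqSmallOn A V ε) {μ : Fin d}
    {u : List (Letter d)} {q : Site d} {g : 𝔸ˣ} (hg : g ∈ U1 𝔸) (hu : ∀ l ∈ u, l.1 ≠ μ) (h1 : PathIn A q u)
    (h2 : PathIn A (q + e μ) u) (hgu : g * hol V q u = 1) (hgu' : g * (V q μ * hol V (q + e μ) u) = 1) :
    ‖((V (q + disp u) μ : 𝔸ˣ) : 𝔸) - 1‖ ≤ u.length * ε := by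
  rw [bond_eq_conj_ladder V g q u μ hgu hgu', Units.val_mul, Units.val_mul]
  exact (norm_units_conj_sub_one_le hg _).trans (norm_hol_ladder_sub_one_le hV hP μ u q hu h1 h2)

/-- **Wide ladder (rectangle of `b` rows)**: if the path `w` moved `j` steps in direction `ν` stays in `A` for
`j = 0, …, b`, the wide ladder deviates by at most `b·|w|·ε` — rows of ladders, each conjugated.
[cite: Balaban1989LargeFieldII, p.382] -/
theorem norm_hol_wideLadder_sub_one_le (hV : ∀ x κ, V x κ ∈ U1 𝔸) (hP : PlaqSmallOn A V ε) (ν : Fin d)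
    (w : List (Letter d)) (hw : ∀ l ∈ w, l.1 ≠ ν) :
    ∀ (b : ℕ) (p : Site d), (∀ j : ℕ, j ≤ b → PathIn A (p + (j : ℤ) • e ν) w) →
      ‖((hol V p (wideLadder w ν b) : 𝔸ˣ) : 𝔸) - 1‖ ≤ b * (w.length * ε)
  | 0, p, _ => by
    rw [hol_wideLadder]
    simp
  | b + 1, p, h => by
    have h0 : PathIn A p w := by simpa using h 0 (Nat.zero_le _)
    have h1 : PathIn A (p + e ν) w := by simpa using h 1 (by omega)
    have ih := norm_hol_wideLadder_sub_one_le hV hP ν w hw b (p + e ν) fun j hj => by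
      have e1 : p + e ν + (j : ℤ) • e ν = p + ((j + 1 : ℕ) : ℤ) • e ν := by
        push_cast; rw [add_zsmul, one_zsmul]; abel
      rw [e1]; exact h (j + 1) (by omega)
    have hlad := norm_hol_ladder_sub_one_le hV hP ν w p hw h0 h1
    rw [hol_wideLadder_succ, Units.val_mul]
    calc _ ≤ ‖((hol V p (ladder w ν) : 𝔸ˣ) : 𝔸) - 1‖ +
          ‖((V p ν * hol V (p + e ν) (wideLadder w ν b) * (V p ν)⁻¹ : 𝔸ˣ) : 𝔸) - 1‖ :=
          B8Ineq170.norm_mul_sub_one_le_of_norm_le_one (mem_U1.mp (hol_mem hV _ _)).1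
      _ ≤ w.length * ε + b * (w.length * ε) := by
          refine add_le_add hlad ?_
          rw [Units.val_mul, Units.val_mul]
          exact (norm_units_conj_sub_one_le (hV p ν) _).trans ih
      _ = ((b + 1 : ℕ) : ℝ) * (w.length * ε) := by push_cast; ring

/-- **A closed loop moved off an obstacle**: if the closed path `w` (no `ν`-letters) moved `j` steps in direction
`ν` stays in `A` for `j = 0, …, h`, then the loop at level `h` deviates by at most `h·|w|·ε` plus the deviation of
the loop at level `0` (the cylinder between the two levels is `h` ladders). [cite: Balaban1989LargeFieldII, p.382] -/
theorem norm_hol_shift_sub_one_le (hV : ∀ x κ, V x κ ∈ U1 𝔸) (hP : PlaqSmallOn A V ε) (ν : Fin d)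
    (w : List (Letter d)) (hw0 : disp w = 0) (hw : ∀ l ∈ w, l.1 ≠ ν) :
    ∀ (h : ℕ) (p : Site d), (∀ j : ℕ, j ≤ h → PathIn A (p + (j : ℤ) • e ν) w) →
      ‖((hol V (p + (h : ℤ) • e ν) w : 𝔸ˣ) : 𝔸) - 1‖ ≤ h * (w.length * ε) + ‖((hol V p w : 𝔸ˣ) : 𝔸) - 1‖
  | 0, p, _ => by simp
  | h + 1, p, hp => by
    set q : Site d := p + (h : ℤ) • e ν with hq
    have hq1 : p + ((h + 1 : ℕ) : ℤ) • e ν = q + e ν := by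
      rw [hq]; push_cast; rw [add_zsmul, one_zsmul, add_assoc]
    have ih := norm_hol_shift_sub_one_le hV hP ν w hw0 hw h p fun j hj => hp j (by omega)
    have hlad : ‖((hol V q (ladder w ν) : 𝔸ˣ) : 𝔸) - 1‖ ≤ w.length * ε :=
      norm_hol_ladder_sub_one_le hV hP ν w q hw (hp h (by omega)) (by rw [← hq1]; exact hp (h + 1) le_rfl)
    rw [hq1, hol_shift_of_closed V q w ν hw0, Units.val_mul, Units.val_mul]
    have hL : ‖(((hol V q (ladder w ν))⁻¹ : 𝔸ˣ) : 𝔸)‖ ≤ 1 := (mem_U1.mp ((U1 𝔸).inv_mem (hol_mem hV _ _))).1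
    calc _ ≤ ‖(((hol V q (ladder w ν))⁻¹ * hol V q w : 𝔸ˣ) : 𝔸) - 1‖ :=
          norm_units_inv_conj_sub_one_le (hV q ν) _
      _ ≤ ‖(((hol V q (ladder w ν))⁻¹ : 𝔸ˣ) : 𝔸) - 1‖ + ‖((hol V q w : 𝔸ˣ) : 𝔸) - 1‖ := by
          rw [Units.val_mul]; exact B8Ineq170.norm_mul_sub_one_le_of_norm_le_one hL
      _ ≤ w.length * ε + (h * (w.length * ε) + ‖((hol V p w : 𝔸ˣ) : 𝔸) - 1‖) :=
          add_le_add ((norm_inv_sub_one_le (hol_mem hV _ _)).trans hlad) ih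
      _ = ((h + 1 : ℕ) : ℝ) * (w.length * ε) + ‖((hol V p w : 𝔸ˣ) : 𝔸) - 1‖ := by push_cast; ring

end Estimates

/-! ## §3 The vertices of a rectangle boundary -/

section RectVertices

variable {S : Set (Site d)} {p : Site d}

/-- The vertices of the boundary of the `a × b` rectangle `p + [0,a]e_κ + [0,b]e_ν` (the wide ladder over a straight
segment) are the sites `p + s e_κ + t e_ν` with `s ∈ {0,a}` or `t ∈ {0,b}`. [cite: Balaban1989LargeFieldII, p.382] -/
theorem pathIn_wideLadder_seg {κ ν : Fin d} {a b : ℕ}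
    (h : ∀ s t : ℕ, s ≤ a → t ≤ b → (s = 0 ∨ s = a ∨ t = 0 ∨ t = b) →
      p + (s : ℤ) • e κ + (t : ℤ) • e ν ∈ S) :
    PathIn S p (wideLadder (seg κ (a : ℤ)) ν b) := by
  rw [wideLadder, revWord_seg, pathIn_append, pathIn_append, pathIn_append]
  simp only [disp_append, disp_seg, neg_zsmul]
  refine ⟨⟨⟨?_, ?_⟩, ?_⟩, ?_⟩
  · rw [pathIn_seg_natCast]
    intro s hs
    simpa using h s 0 hs (Nat.zero_le _) (Or.inr (Or.inr (Or.inl rfl)))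
  · rw [pathIn_seg_natCast]
    intro t ht
    exact h a t le_rfl ht (Or.inr (Or.inl rfl))
  · rw [pathIn_seg_neg]
    intro s hs
    have := h (a - s) b (Nat.sub_le _ _) le_rfl (Or.inr (Or.inr (Or.inr rfl)))
    rw [Nat.cast_sub hs, sub_zsmul] at this
    convert this using 1
    abel
  · rw [pathIn_seg_neg]
    intro t ht
    have := h 0 (b - t) (Nat.zero_le _) (Nat.sub_le _ _) (Or.inl rfl)
    rw [Nat.cast_sub ht, sub_zsmul, Nat.cast_zero, zero_zsmul, add_zero] at this
    convert this using 1
    abel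

end RectVertices

end Literature.MathematicalPhysics.QuantumFieldTheory.Balaban1983to89.B16Ineq382
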